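import Mathlib
import HarnessLib
import Summits.NavierStokesRegularity.NavierStokesRegularity.Theses.LocalLambTubeDoor
import Summits.NavierStokesRegularity.NavierStokesRegularity.Theorems.LocalSineTubeDoorLocalPointZoomGradSlices
import Summits.NavierStokesRegularity.NavierStokesRegularity.Theorems.LocalLambTubeDoorTarget

/-!
# Route `LocalLambTubeDoor` (S12, rung N0-LocalTubeDoorLamb) — the rung leaf TARGET is a THEOREM

Cell ns-regularity-ideate, seat p6 (birth filing; the route was opened from the staged package
HOME/ns-regularity-ideate-p6/route-lamb/).  Two independent certificates of the leaf against the born Theses decl (closing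
item stmt-NavierStokesRegularity-19813; capstone for `route close --proved`): `target_proof` = the gate-certified `closes` applied to the two
crux theorems (K1 = `localPointZoomVelGradSlices` p441522; K2 ⇐ `not_backwardSingular_of_beltrami ∘ lambWindowToSlab`
p455778), and `target_proof_direct` = the door theorem `…Theorems.LocalLambTubeDoorTarget.localTubeDoorLamb` (p456216), whose
statement the leaf text copies verbatim.

WHAT THIS IS NOT: not a claim about Navier–Stokes regularity (Clay A).  The leaf is a regularity CRITERION (local Type I
+ L¹-fading of the scale-normalised Lamb vector (T−t)^{3/2}·u × curl u on ONE similarity window ⇒ backward bounded), one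
rung of LADDER-NS N0 (N0-LocalTubeDoorLamb); establishment in the cell's sense still requires the cross-family referee
PASS + independent reproduction.
-/

noncomputable section

-- the summit and its single sub-problem share the name (CONVENTIONS §1), as in every Theorems file
set_option linter.dupNamespace false

namespace Summit.NavierStokesRegularity.NavierStokesRegularity.Theorems.LocalLambTubeDoorTargetClose

open Set Literature.Analysis Literature.Analysis.FluidPDE
open Summit.NavierStokesRegularity.NavierStokesRegularity.Theses.LocalLambTubeDoor
open Summit.NavierStokesRegularity.NavierStokesRegularity.Theorems.LocalSineTubeDoorLocalPointZoomGradSlices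
open Summit.NavierStokesRegularity.NavierStokesRegularity.Theorems.LocalSineTubeDoorProfileAlignedWindowRigidityAncient
open Summit.NavierStokesRegularity.NavierStokesRegularity.Theorems.LocalLambTubeDoorBeltramiProfileRigidity
open Summit.NavierStokesRegularity.NavierStokesRegularity.Theorems.LocalLambTubeDoorTarget

/-- **The rung leaf `Target` (item stmt-NavierStokesRegularity-19813, rung N0-LocalTubeDoorLamb) is a THEOREM**: `closes` applied to the
two crux theorems (both cruxes discharged inline: K1 by `localPointZoomVelGradSlices`, K2 by slice analyticity +
`not_backwardSingular_of_beltrami ∘ lambWindowToSlab`). -/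
theorem target_proof :
    Summit.NavierStokesRegularity.NavierStokesRegularity.Theses.LocalLambTubeDoor.Target :=
  closes
    (by
      unfold Summit.NavierStokesRegularity.NavierStokesRegularity.Theses.LocalLambTubeDoor.LocalPointZoomVelGradSlices
      exact localPointZoomVelGradSlices)
    (by
      intro C v hr hc hm hd
      refine ⟨fun s hs => ?_,
        fun hwin => not_backwardSingular_of_beltrami hr hc hm hd (lambWindowToSlab hr hc hm hwin)⟩
      rw [← continuousOn_univ]
      exact (analyticOnNhd_curl (analyticOnNhd_slice hc (bdd_of_hasTypeITimeDecay hr) hm hs)).continuousOn)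

/-- **Second, glue-independent certificate of the leaf**: the born `Target` text is verbatim the statement of the door
theorem `localTubeDoorLamb` (p456216). -/
theorem target_proof_direct :
    Summit.NavierStokesRegularity.NavierStokesRegularity.Theses.LocalLambTubeDoor.Target :=
  localTubeDoorLamb

end Summit.NavierStokesRegularity.NavierStokesRegularity.Theorems.LocalLambTubeDoorTargetClose

end
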